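import Summits.QuantumAdvantage.QuantumAdvantage.Theorems.CubicForrelationNearExactIsExactTwelveLevelFiveOffFlat930
import Summits.QuantumAdvantage.QuantumAdvantage.Theorems.CubicForrelationNearExactIsExactTwelveLevelFive932Dead

/-!
# Crux `CubicForrelation.NearExactIsExact` (stmt-QuantumAdvantage-14043) — n = 12: NO level-5 side in the whole window `Φ > 930/1024`

Certificate seat `b2b-cforr-cert` (gen 18).  HONEST FRAMING: a kernel-checked structure-plus-exclusion theorem (standard axioms) about cubic Boolean
pairs on 12 bits; it removes the level-5 branch from the rungs `931/1024` and `932/1024` (and the grid points between `930/1024` and `1`); it does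
NOT produce a new value of `θ₁₂` by itself.  NOT summit progress.

`tw19_levelFive_gt930_structure`: for a level-5 side `g` (`W_g = 32u'`, `u'` odd somewhere) with `Φ(f,g) > 930/1024` the budget is
`Σ_P (e² − 1) ≤ 959` (`e = u' − 2(−1)^f`, `P` the odd hyperplane, `e = 0` off `P` by `tw19_off_flat_930`); the parity cascade of
`tw15_levelFive_932_false` closes the layers `/4` (`1024 > 959`) and `/8` (`1536 > 959`), and the layer `/16` on 10-flats has exactly FOUR odd
quotients (`5·224 > 959`), each of cost exactly `224` (`|e| = 17` would cost `288`, and `3·224 + 288 = 960 > 959`), all other points of `P` having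
`e = σ` (`32 ∣ e − σ`, and `e ≠ σ` costs `≥ 960`).  Hence `Σ e² = 2944` and `Φ = 932/1024` EXACTLY, with the structure `u' = 2(−1)^f + σ(1_P − 16·1_T)`.
`tw19_levelFive_gt_930_false`: combine with `tw19_levelFive_932_false` (…TwelveLevelFive932Dead).

References: J. Ax (1964) / R. J. McEliece (1972); MacWilliams–Sloane (1977) Ch. 13 §3, Ch. 15; C. Carlet (2021) §4.1, §5.2.  Everything below
is proved from Mathlib and the tree; axioms are the standard three.
-/

set_option linter.dupNamespace false -- D-0017: single-problem summit ⇒ `QuantumAdvantage.QuantumAdvantage` by design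

noncomputable section

namespace Summit.QuantumAdvantage.QuantumAdvantage.Theorems.CubicForrelation.NearExactIsExact

open Finset
open Literature.Computability.QuantumComplexity
open Literature.Computability.QuantumComplexity.BuzetChailloux (bxor zeroVec bxor_bxor_cancel_left bxor_zeroVec zeroVec_bxor bxor_comm
  bxor_self twist_zeroVec_right twist_bxor_right)
open Literature.Computability.QuantumComplexity.DerivativeWalsh (W)

/-- **Structure of a level-5 side at `Φ > 930/1024` on 12 bits, and `Φ = 932/1024`** (see the module docstring).  Finite-slice statement,
NOT summit progress. [this work] -/
theorem tw19_levelFive_gt930_structure (f g : (Fin (6 + 6) → Bool) → Bool) (hf : IsDegLeFun 3 f) (hg : IsDegLeFun 3 g)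
    (u' : (Fin (6 + 6) → Bool) → ℤ) (hu' : ∀ x, W (fun y => signOf (g y)) x = (2 : ℝ) ^ 5 * (u' x : ℝ))
    (hodd : ∃ x, Odd (u' x)) (hΦ : (930 / 1024 : ℝ) < forrelation f g) :
    ∃ (γ : Fin (6 + 6) → Bool) (tg : ℝ) (D : (Fin (6 + 6) → Bool) → Bool) (T : Finset (Fin (6 + 6) → Bool)),
      (tg = 1 ∨ tg = -1) ∧ γ ≠ zeroVec ∧ (∀ x, (Odd (u' x) ↔ twist γ x = tg)) ∧ IsDegLeFun 2 D ∧ #T = 4 ∧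
      (∀ x ∈ T, Odd (u' x)) ∧ (∀ x, ¬ Odd (u' x) → u' x = 2 * sZ (f x)) ∧
      (∀ x, Odd (u' x) → x ∉ T → u' x = 2 * sZ (f x) + sZ (D x)) ∧ (∀ x ∈ T, u' x = 2 * sZ (f x) - 15 * sZ (D x)) ∧
      forrelation f g = 932 / 1024 := by
  classical
  -- `u = 2u'` at the Ax level `4`; residual `e = u' − 2s`, budget `B = Σ e² = 2¹⁵(1 − Φ) < 2944`
  set u : (Fin (6 + 6) → Bool) → ℤ := fun x => 2 * u' x with hudef
  have hu : ∀ x, W (fun y => signOf (g y)) x = (2 : ℝ) ^ 4 * (u x : ℝ) := by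
    intro x; rw [hu' x]; simp only [u]; push_cast; ring
  set e : (Fin (6 + 6) → Bool) → ℤ := fun x => u' x - 2 * sZ (f x) with hedef
  have hbud := tw12_budget f g u hu
  have h4e : ∀ x, (u x - 4 * sZ (f x)) ^ 2 = 4 * e x ^ 2 := fun x => by simp only [u, e]; ring
  have hBR : ((∑ x, e x ^ 2 : ℤ) : ℝ) = 32768 * (1 - forrelation f g) := by
    have h' : ((∑ x, (u x - 4 * sZ (f x)) ^ 2 : ℤ) : ℝ) = 4 * ((∑ x, e x ^ 2 : ℤ) : ℝ) := by
      rw [sum_congr rfl fun x _ => h4e x, ← mul_sum]; push_cast; ring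
    rw [h'] at hbud
    linarith
  have hB_le : (∑ x, e x ^ 2 : ℤ) ≤ 3007 := by
    have h' : ((∑ x, e x ^ 2 : ℤ) : ℝ) < 3008 := by rw [hBR]; linarith
    have h'' : (∑ x, e x ^ 2 : ℤ) < 3008 := by exact_mod_cast h'
    omega
  -- off the hyperplane the pair is exact
  have hoff := tw19_off_flat_930 f g hf hg u' hu' hodd hΦ
  have he0 : ∀ y, ¬ Odd (u' y) → e y = 0 := fun y hy => by
    show u' y - 2 * sZ (f y) = 0
    rw [hoff y hy]; ring
  -- the odd hyperplane `P = x₀ ⊕ V` and the quadratic digit `D`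
  obtain ⟨γ, tg, htg, hγ0, hPg⟩ := tw19_hyperplane_930 f g hg u' hu' hodd hΦ
  obtain ⟨i, hγi⟩ := tw59_exists_coord γ hγ0
  obtain ⟨D, hD, hDig⟩ := tw59_quadratic_digit f g hg u' hu' γ tg hPg i hγi hoff
  set P := univ.filter (fun x : Fin (6 + 6) → Bool => Odd (u' x)) with hPdef
  have hmemP : ∀ x, x ∈ P ↔ Odd (u' x) := fun x => by simp [hPdef]
  have hmemP' : ∀ x, x ∈ P ↔ twist γ x = tg := fun x => by rw [hmemP, hPg]
  set V := univ.filter (fun a : Fin (6 + 6) → Bool => twist γ a = 1) with hVdef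
  have hVmem : ∀ a, a ∈ V ↔ twist γ a = 1 := fun a => by rw [hVdef, mem_filter]; simp
  have hV0 : zeroVec ∈ V := (hVmem _).2 (twist_zeroVec_right γ)
  have hVadd : ∀ x ∈ V, ∀ y ∈ V, bxor x y ∈ V := by
    intro x hx y hy; rw [hVmem] at hx hy ⊢; rw [twist_bxor_right, hx, hy, mul_one]
  have hVcard : #V = 2 ^ 11 := by rw [hVdef, tw59_card_half γ hγ0 1 (Or.inl rfl)]; norm_num
  obtain ⟨x₀, hx₀⟩ := id hodd
  have hx₀P : x₀ ∈ P := (hmemP x₀).2 hx₀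
  have hPimg : P = V.image (bxor x₀) := tw59_eq_image P V γ tg hmemP' hVmem x₀ hx₀P
  have hPV : ∀ x, x ∈ P → ∀ a ∈ V, bxor x a ∈ P := fun x hx a ha => fl1_coset_vadd hVadd hPimg hx ha
  have hcardP : #P = 2048 := by
    have e1 : P = univ.filter (fun x : Fin (6 + 6) → Bool => twist γ x = tg) := by
      ext x; rw [hmemP', mem_filter]; simp
    rw [e1]; exact tw59_card_half γ hγ0 tg htg
  -- cost accounting on `P`
  have heodd : ∀ x, x ∈ P → Odd (e x) := by
    intro x hx
    exact Int.odd_sub.2 (iff_of_true ((hmemP x).1 hx) ⟨sZ (f x), two_mul _⟩)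
  have hsq1 : ∀ x, x ∈ P → 1 ≤ e x ^ 2 := by
    intro x hx
    have h0 := Int.odd_iff.1 (heodd x hx)
    have : e x ≤ -1 ∨ 1 ≤ e x := by omega
    have := tp_sq_ge (k := 1) (by norm_num) this
    linarith
  have hsplit : (∑ x, e x ^ 2 : ℤ) = ∑ x ∈ P, e x ^ 2 :=
    (sum_subset (subset_univ P) fun x _ hx => by
      rw [he0 x (fun h => hx ((hmemP x).2 h))]; ring).symm
  have hPsum : ∑ x ∈ P, e x ^ 2 ≤ 3007 := by rw [← hsplit]; exact hB_le
  have hcost : ∀ (T : Finset (Fin (6 + 6) → Bool)) (c : ℤ), T ⊆ P → (∀ x ∈ T, c ≤ e x ^ 2 - 1) → c * #T ≤ 959 := by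
    intro T c hT hc
    have h1 : c * #T ≤ ∑ x ∈ T, (e x ^ 2 - 1) := by
      calc c * #T = ∑ x ∈ T, c := by rw [sum_const, nsmul_eq_mul, mul_comm]
        _ ≤ ∑ x ∈ T, (e x ^ 2 - 1) := sum_le_sum hc
    have h2 : ∑ x ∈ T, (e x ^ 2 - 1) ≤ ∑ x ∈ P, (e x ^ 2 - 1) :=
      sum_le_sum_of_subset_of_nonneg hT fun x hx _ => by linarith [hsq1 x hx]
    have h3 : ∑ x ∈ P, (e x ^ 2 - 1) = ∑ x ∈ P, e x ^ 2 - 2048 := by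
      rw [sum_sub_distrib, sum_const, hcardP]; norm_num
    linarith
  -- flat sums of `e = u' − 2s`: `8 ∣` on 5-flats, `16 ∣` on 7-flats, `32 ∣` on 10-flats
  have hflat : ∀ (k c : ℕ) (M : ℤ), (2 : ℤ) ^ (c + 1) = 2 * M → 4 + (c + 1) ≤ k + (6 + 6 - k + 2) / 3 → M ∣ 2 * 2 ^ ((k + 2) / 3) →
      ∀ (b : Fin (6 + 6) → Bool) (a : Fin k → Fin (6 + 6) → Bool),
      M ∣ ∑ ε : Fin k → Bool, e (fun j => b j ^^ decide (Odd #(univ.filter fun i => ε i && a i j))) := by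
    intro k c M hM hk hM' b a
    have h1 := fs_flat_sum_dvd (e := c + 1) g u hg hu b a hk
    obtain ⟨zf, hzf⟩ := sl_sum_sZ_flat f hf b a
    have hzf' : ∑ ε : Fin k → Bool, 2 * sZ (f (fun j => b j ^^ decide (Odd #(univ.filter fun i => ε i && a i j)))) =
        2 * 2 ^ ((k + 2) / 3) * zf := by
      rw [← mul_sum, hzf, ← mul_assoc]
    have h1' : 2 * M ∣ 2 * ∑ ε : Fin k → Bool, u' (fun j => b j ^^ decide (Odd #(univ.filter fun i => ε i && a i j))) := by
      rw [← hM, mul_sum]; exact h1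
    have h1'' : M ∣ ∑ ε : Fin k → Bool, u' (fun j => b j ^^ decide (Odd #(univ.filter fun i => ε i && a i j))) :=
      (mul_dvd_mul_iff_left two_ne_zero).1 h1'
    have h3 : ∑ ε : Fin k → Bool, e (fun j => b j ^^ decide (Odd #(univ.filter fun i => ε i && a i j))) =
        ∑ ε : Fin k → Bool, u' (fun j => b j ^^ decide (Odd #(univ.filter fun i => ε i && a i j))) -
        ∑ ε : Fin k → Bool, 2 * sZ (f (fun j => b j ^^ decide (Odd #(univ.filter fun i => ε i && a i j)))) := by
      rw [← sum_sub_distrib]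
    rw [h3, hzf']
    exact dvd_sub h1'' (dvd_mul_of_dvd_left hM' _)
  have hflat5 := hflat 5 3 8 (by norm_num) (by norm_num) (by norm_num)
  have hflat7 := hflat 7 4 16 (by norm_num) (by norm_num) (by norm_num)
  have hflat10 := hflat 10 5 32 (by norm_num) (by norm_num) (by norm_num)
  -- flat sums of the quadratic sign `σ = (−1)^D`: `8 ∣`, `16 ∣`, `32 ∣`
  have hquad5 : ∀ (b : Fin (6 + 6) → Bool) (a : Fin 5 → Fin (6 + 6) → Bool),
      (8 : ℤ) ∣ ∑ ε : Fin 5 → Bool, sZ (D (fun j => b j ^^ decide (Odd #(univ.filter fun i => ε i && a i j)))) := by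
    intro b a; have h := tw15_quad_flat_sum D hD b a; rw [show (2 : ℤ) ^ ((5 + 1) / 2) = 8 by norm_num] at h; exact h
  have hquad7 : ∀ (b : Fin (6 + 6) → Bool) (a : Fin 7 → Fin (6 + 6) → Bool),
      (16 : ℤ) ∣ ∑ ε : Fin 7 → Bool, sZ (D (fun j => b j ^^ decide (Odd #(univ.filter fun i => ε i && a i j)))) := by
    intro b a; have h := tw15_quad_flat_sum D hD b a; rw [show (2 : ℤ) ^ ((7 + 1) / 2) = 16 by norm_num] at h; exact h
  have hquad10 : ∀ (b : Fin (6 + 6) → Bool) (a : Fin 10 → Fin (6 + 6) → Bool),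
      (32 : ℤ) ∣ ∑ ε : Fin 10 → Bool, sZ (D (fun j => b j ^^ decide (Odd #(univ.filter fun i => ε i && a i j)))) := by
    intro b a; have h := tw15_quad_flat_sum D hD b a; rw [show (2 : ℤ) ^ ((10 + 1) / 2) = 32 by norm_num] at h; exact h
  -- combined: the flat sums of `e − σ`
  have hcomb : ∀ (k : ℕ) (M : ℤ),
      (∀ (b : Fin (6 + 6) → Bool) (a : Fin k → Fin (6 + 6) → Bool),
        M ∣ ∑ ε : Fin k → Bool, e (fun j => b j ^^ decide (Odd #(univ.filter fun i => ε i && a i j)))) →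
      (∀ (b : Fin (6 + 6) → Bool) (a : Fin k → Fin (6 + 6) → Bool),
        M ∣ ∑ ε : Fin k → Bool, sZ (D (fun j => b j ^^ decide (Odd #(univ.filter fun i => ε i && a i j))))) →
      ∀ (b : Fin (6 + 6) → Bool) (a : Fin k → Fin (6 + 6) → Bool),
        M ∣ ∑ ε : Fin k → Bool, (e (fun j => b j ^^ decide (Odd #(univ.filter fun i => ε i && a i j))) -
          sZ (D (fun j => b j ^^ decide (Odd #(univ.filter fun i => ε i && a i j))))) := by
    intro k M he hD' b a
    rw [sum_sub_distrib]
    exact dvd_sub (he b a) (hD' b a)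
  have hcomb5 := hcomb 5 8 hflat5 hquad5
  have hcomb7 := hcomb 7 16 hflat7 hquad7
  have hcomb10 := hcomb 10 32 hflat10 hquad10
  -- on `P`: `4 ∣ e − σ`
  have hdig4 : ∀ x, x ∈ P → (4 : ℤ) ∣ e x - sZ (D x) := fun x hx => hDig x ((hmemP x).1 hx)
  -- ONE ROUND of wild-point parity on `P`: if `q ∣ e − σ` on `P`, the flat layer gives `2q ∣` on flats, and odd quotients are
  -- too expensive, then `2q ∣ e − σ` on `P`
  have hround : ∀ (q : ℤ) (r : ℕ) (c : ℤ), 0 < q →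
      (∀ x, x ∈ P → q ∣ e x - sZ (D x)) →
      (∀ (b : Fin (6 + 6) → Bool) (a : Fin (r + 1) → Fin (6 + 6) → Bool),
        2 * q ∣ ∑ ε : Fin (r + 1) → Bool, (e (fun j => b j ^^ decide (Odd #(univ.filter fun i => ε i && a i j))) -
          sZ (D (fun j => b j ^^ decide (Odd #(univ.filter fun i => ε i && a i j)))))) →
      (∀ x, x ∈ P → Odd ((e x - sZ (D x)) / q) → c ≤ e x ^ 2 - 1) →
      959 < c * 2 ^ (11 - r) → 0 ≤ c → r ≤ 11 →
      ∀ x, x ∈ P → 2 * q ∣ e x - sZ (D x) := by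
    intro q r c hq hdiv hlayer hc hbudget hc0 hr
    have hq' : ∀ y, y ∈ P → e y - sZ (D y) = q * ((e y - sZ (D y)) / q) := fun y hy => (Int.mul_ediv_cancel' (hdiv y hy)).symm
    rcases ws_erm_round V hV0 hVadd hVcard x₀ (fun y => (e y - sZ (D y)) / q) r (fun b hb a ha => by
        have hbP : b ∈ P := by rw [hPimg]; exact hb
        have hpts : ∀ ε : Fin (r + 1) → Bool, (fun j => b j ^^ decide (Odd #(univ.filter fun i => ε i && a i j))) ∈ P :=
          fun ε => ws_flatPt_mem V hV0 (· ∈ P) hPV (r + 1) b hbP a ha ε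
        have h := hlayer b a
        rw [sum_congr rfl fun ε _ => hq' _ (hpts ε), ← mul_sum] at h
        exact (mul_dvd_mul_iff_left hq.ne').1 (by rw [mul_comm q 2]; exact h)) with hev | hbig
    · intro x hx
      obtain ⟨k, hk⟩ := hev x (by rw [← hPimg]; exact hx)
      exact ⟨k, by rw [hq' x hx, hk]; ring⟩
    · exfalso
      rw [← hPimg] at hbig
      have hT := hcost (P.filter fun x => Odd ((e x - sZ (D x)) / q)) c (filter_subset _ _) (fun x hx => by
          have hx' := mem_filter.1 hx
          exact hc x hx'.1 hx'.2)
      -- `2^11 ≤ 2^r · #T` and `c · #T ≤ 959 < c · 2^{11−r}`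
      have hTcard : 2 ^ (11 - r) ≤ #(P.filter fun x => Odd ((e x - sZ (D x)) / q)) := by
        have e11 : 2 ^ 11 = 2 ^ r * 2 ^ (11 - r) := by rw [← pow_add]; congr 1; omega
        rw [e11] at hbig
        exact Nat.le_of_mul_le_mul_left hbig (by positivity)
      have : c * 2 ^ (11 - r) ≤ c * #(P.filter fun x => Odd ((e x - sZ (D x)) / q)) := by
        have h' : ((2 : ℤ) ^ (11 - r) : ℤ) ≤ (#(P.filter fun x => Odd ((e x - sZ (D x)) / q)) : ℤ) := by exact_mod_cast hTcard
        exact mul_le_mul_of_nonneg_left h' hc0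
      linarith
  -- a point with `q ∣ e − σ`, odd quotient, has `|e| ≥ q − 1`
  have hptcost : ∀ (q c : ℤ), 2 ≤ q → (q - 1) ^ 2 - 1 = c → ∀ x, x ∈ P → q ∣ e x - sZ (D x) → Odd ((e x - sZ (D x)) / q) →
      c ≤ e x ^ 2 - 1 := by
    intro q c hq hc x hx hdiv hoddq
    have hq' : e x - sZ (D x) = q * ((e x - sZ (D x)) / q) := (Int.mul_ediv_cancel' hdiv).symm
    set t := (e x - sZ (D x)) / q with ht
    have ht1 : t ≤ -1 ∨ 1 ≤ t := by have := Int.odd_iff.1 hoddq; omega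
    have hs := tp_sZ_cases (D x)
    have key : e x ≤ -(q - 1) ∨ q - 1 ≤ e x := by
      rcases ht1 with ht1 | ht1
      · left
        have : q * t ≤ q * (-1) := mul_le_mul_of_nonneg_left ht1 (by linarith)
        rcases hs with hs | hs <;> rw [hs] at hq' <;> linarith
      · right
        have : q * 1 ≤ q * t := mul_le_mul_of_nonneg_left ht1 (by linarith)
        rcases hs with hs | hs <;> rw [hs] at hq' <;> linarith
    have := tp_sq_ge (k := q - 1) (by linarith) key
    linarith
  -- rounds: `8 ∣`, `16 ∣`, `32 ∣ e − σ` on `P`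
  have hr1 : ∀ x, x ∈ P → (8 : ℤ) ∣ e x - sZ (D x) := by
    have h := hround 4 4 8 (by norm_num) hdig4 (fun b a => hcomb5 b a) (fun x hx hq => hptcost 4 8 (by norm_num) (by norm_num) x hx
      (hdig4 x hx) hq) (by norm_num) (by norm_num) (by norm_num)
    intro x hx; have := h x hx; norm_num at this; exact this
  have hr2 : ∀ x, x ∈ P → (16 : ℤ) ∣ e x - sZ (D x) := by
    have h := hround 8 6 48 (by norm_num) hr1 (fun b a => hcomb7 b a) (fun x hx hq => hptcost 8 48 (by norm_num) (by norm_num) x hx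
      (hr1 x hx) hq) (by norm_num) (by norm_num) (by norm_num)
    intro x hx; have := h x hx; norm_num at this; exact this
  -- the LAST layer `(e − σ)/16` on 10-flats at budget `≤ 959`: four odd quotients, each costing exactly `224`, nothing else
  have hq' : ∀ y, y ∈ P → e y - sZ (D y) = 16 * ((e y - sZ (D y)) / 16) := fun y hy => (Int.mul_ediv_cancel' (hr2 y hy)).symm
  set T := P.filter (fun x => Odd ((e x - sZ (D x)) / 16)) with hTdef
  have hTP : T ⊆ P := filter_subset _ _
  have hsumP : ∑ x ∈ P, (e x ^ 2 - 1) ≤ 959 := by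
    have h3 : ∑ x ∈ P, (e x ^ 2 - 1) = ∑ x ∈ P, e x ^ 2 - 2048 := by
      rw [sum_sub_distrib, sum_const, hcardP]; norm_num
    linarith
  rcases ws_erm_round V hV0 hVadd hVcard x₀ (fun y => (e y - sZ (D y)) / 16) 9 (fun b hb a ha => by
      have hbP : b ∈ P := by rw [hPimg]; exact hb
      have hpts : ∀ ε : Fin (9 + 1) → Bool, (fun j => b j ^^ decide (Odd #(univ.filter fun i => ε i && a i j))) ∈ P :=
        fun ε => ws_flatPt_mem V hV0 (· ∈ P) hPV (9 + 1) b hbP a ha ε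
      have h := hcomb10 b a
      rw [sum_congr rfl fun ε _ => hq' _ (hpts ε), ← mul_sum] at h
      exact (mul_dvd_mul_iff_left (by norm_num : (16 : ℤ) ≠ 0)).1 (by rw [show (16 : ℤ) * 2 = 32 by norm_num]; exact h)) with hev | hbig
  · /- no odd quotient: `32 ∣ e − σ` on `P`, then `e = σ` on `P`, `Φ = 15/16`, excluded — this branch is empty -/
    exfalso
    have hr3 : ∀ x, x ∈ P → (32 : ℤ) ∣ e x - sZ (D x) := by
      intro x hx
      obtain ⟨k, hk⟩ := hev x (by rw [← hPimg]; exact hx)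
      exact ⟨k, by rw [hq' x hx, hk]; ring⟩
    -- a single point with `e ≠ σ` costs `≥ 960 > 896`
    have hfin : ∀ x, x ∈ P → e x = sZ (D x) := by
      intro x hx
      by_contra hne
      obtain ⟨t, ht⟩ := hr3 x hx
      have ht0 : t ≠ 0 := by intro h; rw [h, mul_zero, sub_eq_zero] at ht; exact hne ht
      have ht1 : t ≤ -1 ∨ 1 ≤ t := by omega
      have hs := tp_sZ_cases (D x)
      have key : e x ≤ -31 ∨ 31 ≤ e x := by
        rcases ht1 with ht1 | ht1 <;> rcases hs with hs | hs <;> rw [hs] at ht <;> omega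
      have h2 := tp_sq_ge (k := 31) (by norm_num) key
      have hT := hcost {x} 960 (singleton_subset_iff.2 hx) (fun y hy => by rw [mem_singleton.1 hy]; linarith)
      rw [card_singleton] at hT
      norm_num at hT
    -- hence `Σ e² = 2048`, `Φ = 15/16`, excluded by `tw12_isolation_ge`
    have hsum : (∑ x, e x ^ 2 : ℤ) = 2048 := by
      have h1 : ∀ x ∈ P, e x ^ 2 = 1 := fun x hx => by
        rw [hfin x hx]; rcases tp_sZ_cases (D x) with h | h <;> rw [h] <;> norm_num
      rw [hsplit, sum_congr rfl h1, sum_const, nsmul_eq_mul, mul_one, hcardP]; norm_num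
    have hΦeq : forrelation f g = 15 / 16 := by
      have h : ((∑ x, e x ^ 2 : ℤ) : ℝ) = 2048 := by exact_mod_cast hsum
      rw [hBR] at h
      linarith
    have h1 := tw12_isolation_ge f g hf hg (by rw [hΦeq])
    rw [h1] at hΦeq
    norm_num at hΦeq
  · /- four odd quotients -/
    rw [← hPimg] at hbig
    have hTge : 4 ≤ #T := by
      have : 2 ^ 11 ≤ 2 ^ 9 * #T := hbig
      omega
    have hTcost : ∀ x ∈ T, (224 : ℤ) ≤ e x ^ 2 - 1 := fun x hx =>
      hptcost 16 224 (by norm_num) (by norm_num) x (hTP hx) (hr2 x (hTP hx)) (mem_filter.1 hx).2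
    have hTle : #T ≤ 4 := by
      have h := hcost T 224 hTP hTcost
      have h' : (#T : ℤ) ≤ 4 := by linarith
      exact_mod_cast h'
    have hTcard : #T = 4 := le_antisymm hTle hTge
    -- near-tightness: off `T` every cost is `0` or `≥ 960`, on `T` it is `224` or `≥ 288`; the slack is only `63`
    have hsplitT : ∑ x ∈ P, (e x ^ 2 - 1) = ∑ x ∈ T, (e x ^ 2 - 1) + ∑ x ∈ P.filter (fun x => ¬ Odd ((e x - sZ (D x)) / 16)), (e x ^ 2 - 1) :=
      (sum_filter_add_sum_filter_not P _ _).symm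
    have hT896 : (896 : ℤ) ≤ ∑ x ∈ T, (e x ^ 2 - 1) := by
      have h1 : ∑ x ∈ T, (224 : ℤ) ≤ ∑ x ∈ T, (e x ^ 2 - 1) := sum_le_sum hTcost
      rw [sum_const, hTcard, nsmul_eq_mul] at h1
      push_cast at h1
      linarith
    have hrest_nn : ∀ x ∈ P.filter (fun x => ¬ Odd ((e x - sZ (D x)) / 16)), (0 : ℤ) ≤ e x ^ 2 - 1 :=
      fun x hx => by linarith [hsq1 x (mem_filter.1 hx).1]
    have hrest_le : ∑ x ∈ P.filter (fun x => ¬ Odd ((e x - sZ (D x)) / 16)), (e x ^ 2 - 1) ≤ 63 := by linarith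
    have hrest0 : ∀ x ∈ P.filter (fun x => ¬ Odd ((e x - sZ (D x)) / 16)), e x = sZ (D x) := by
      intro x hx
      have hxP := (mem_filter.1 hx).1
      obtain ⟨k, hk⟩ := hr2 x hxP
      have hk' : (e x - sZ (D x)) / 16 = k := by rw [hk]; simp
      have hkev : ¬ Odd k := by rw [← hk']; exact (mem_filter.1 hx).2
      by_contra hne
      have hk0 : k ≠ 0 := by
        intro h0; rw [h0, mul_zero, sub_eq_zero] at hk; exact hne hk
      have hk2 : k ≤ -2 ∨ 2 ≤ k := by
        have := Int.not_odd_iff_even.1 hkev; obtain ⟨j, hj⟩ := this; omega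
      have hbig : 960 ≤ e x ^ 2 - 1 := by
        have hs := tp_sZ_cases (D x)
        have : e x ≤ -31 ∨ 31 ≤ e x := by rcases hs with hs | hs <;> rw [hs] at hk <;> omega
        have := tp_sq_ge (k := 31) (by norm_num) this; linarith
      have hle : e x ^ 2 - 1 ≤ ∑ y ∈ P.filter (fun x => ¬ Odd ((e x - sZ (D x)) / 16)), (e y ^ 2 - 1) :=
        single_le_sum (f := fun y => e y ^ 2 - 1) hrest_nn hx
      linarith
    have hrest_sum0 : ∑ x ∈ P.filter (fun x => ¬ Odd ((e x - sZ (D x)) / 16)), (e x ^ 2 - 1) = 0 :=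
      sum_eq_zero fun x hx => by rw [hrest0 x hx]; rcases tp_sZ_cases (D x) with h | h <;> rw [h] <;> norm_num
    have hT_nn : ∀ x ∈ T, (0 : ℤ) ≤ e x ^ 2 - 1 - 224 := fun x hx => by linarith [hTcost x hx]
    have hTsum_le : ∑ x ∈ T, (e x ^ 2 - 1 - 224) ≤ 63 := by
      have h1 : ∑ x ∈ T, (e x ^ 2 - 1 - 224) = ∑ x ∈ T, (e x ^ 2 - 1) - 896 := by
        rw [sum_sub_distrib, sum_const, hTcard]; norm_num
      linarith
    have hT225 : ∀ x ∈ T, e x ^ 2 = 225 := by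
      intro x hx
      have hle : e x ^ 2 - 1 - 224 ≤ ∑ y ∈ T, (e y ^ 2 - 1 - 224) := single_le_sum (f := fun y => e y ^ 2 - 1 - 224) hT_nn hx
      have h288 : e x ^ 2 ≤ 288 := by linarith
      have h225 : 225 ≤ e x ^ 2 := by linarith [hTcost x hx]
      have h15 : 15 ≤ e x ∨ e x ≤ -15 := by
        by_contra h
        push Not at h
        nlinarith [h.1, h.2]
      have h16 : e x ≤ 16 ∧ -16 ≤ e x := by
        constructor <;> by_contra h <;> push Not at h <;> nlinarith
      have hodd' := Int.odd_iff.1 (heodd x (hTP hx))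
      have : e x = 15 ∨ e x = -15 := by omega
      rcases this with h | h <;> rw [h] <;> norm_num
    -- the value: `Σ e² = 2048 + 896`, `Φ = 932/1024`
    have hsumT : ∑ x ∈ T, (e x ^ 2 - 1) = 896 := by
      rw [sum_congr rfl fun x hx => by rw [hT225 x hx], sum_const, hTcard]; norm_num
    have hsumE : (∑ x, e x ^ 2 : ℤ) = 2944 := by
      have h1 : ∑ x ∈ P, e x ^ 2 = ∑ x ∈ P, (e x ^ 2 - 1) + 2048 := by
        rw [sum_sub_distrib, sum_const, hcardP]; norm_num
      rw [hsplit, h1, hsplitT, hsumT, hrest_sum0]; norm_num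
    have hΦeq : forrelation f g = 932 / 1024 := by
      have h := hBR
      rw [hsumE] at h
      push_cast at h
      linarith
    refine ⟨γ, tg, D, T, htg, hγ0, hPg, hD, hTcard, fun x hx => (hmemP x).1 (hTP hx), hoff, fun x hx hxT => ?_, fun x hx => ?_, hΦeq⟩
    · -- off `T` on `P`: `e = σ`
      have hxP : x ∈ P := (hmemP x).2 hx
      have hx' : x ∈ P.filter (fun x => ¬ Odd ((e x - sZ (D x)) / 16)) := by
        rw [mem_filter]; refine ⟨hxP, fun hodd' => hxT (mem_filter.2 ⟨hxP, hodd'⟩)⟩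
      have h1 := hrest0 x hx'
      show u' x = 2 * sZ (f x) + sZ (D x)
      have : e x = u' x - 2 * sZ (f x) := rfl
      linarith
    · -- on `T`: `e² = 225` and `16 ∣ e − σ` force `e = −15σ`
      have hxP : x ∈ P := hTP hx
      have h1 := hT225 x hx
      obtain ⟨k, hk⟩ := hr2 x hxP
      have hs := tp_sZ_cases (D x)
      have key : e x = -15 * sZ (D x) := by
        have hsq : (e x - 15) * (e x + 15) = 0 := by nlinarith
        rcases mul_eq_zero.1 hsq with h | h <;> rcases hs with hs | hs <;> rw [hs] at hk ⊢ <;> omega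
      show u' x = 2 * sZ (f x) - 15 * sZ (D x)
      have : e x = u' x - 2 * sZ (f x) := rfl
      linarith

/-- **No level-5 side for `Φ > 930/1024` on 12 bits**: the structure theorem forces `Φ = 932/1024`, and there `tw19_levelFive_932_false`
applies.  So in the whole window `(930/1024, 1)` a cubic pair has no side at Ax level exactly `5`.  Finite-slice statement, NOT summit progress.
[this work] -/
theorem tw19_levelFive_gt_930_false (f g : (Fin (6 + 6) → Bool) → Bool) (hf : IsDegLeFun 3 f) (hg : IsDegLeFun 3 g)
    (u' : (Fin (6 + 6) → Bool) → ℤ) (hu' : ∀ x, W (fun y => signOf (g y)) x = (2 : ℝ) ^ 5 * (u' x : ℝ))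
    (hodd : ∃ x, Odd (u' x)) (hΦ : (930 / 1024 : ℝ) < forrelation f g) : False := by
  obtain ⟨-, -, -, -, -, -, -, -, -, -, -, -, -, hΦeq⟩ := tw19_levelFive_gt930_structure f g hf hg u' hu' hodd hΦ
  exact tw19_levelFive_932_false f g hf hg u' hu' hodd (by rw [hΦeq])

/-- **Packaging at `Fin 12`**: no cubic pair on 12 bits with `W_g = 32u'`, `u'` odd somewhere, has `Φ > 930/1024`. [this work] -/
theorem levelFive_gt_930_false_twelve : ∀ f g : (Fin 12 → Bool) → Bool, IsDegLeFun 3 f → IsDegLeFun 3 g →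
    ∀ u' : (Fin 12 → Bool) → ℤ, (∀ x, W (fun y => signOf (g y)) x = 32 * (u' x : ℝ)) → (∃ x, Odd (u' x)) →
    (930 / 1024 : ℝ) < forrelation f g → False :=
  fun f g hf hg u' hu' hodd hΦ => tw19_levelFive_gt_930_false f g hf hg u' (fun x => (hu' x).trans (by norm_num)) hodd hΦ

end Summit.QuantumAdvantage.QuantumAdvantage.Theorems.CubicForrelation.NearExactIsExact

end
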